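import Literature.NumberTheory.Rogawski1990.RankOneUnstableRamifiedUnitSimilitude   -- ★ p843548 A-p19 (g23): R-0 package `exists_unitSimilitudePartner_of_ramified` (LocalRing currency), `hram` bridge
import HarnessLib

/-!
# (R1-ram, R-0b) THE ONE-PLACE READING OF THE RAMIFIED UNIT SIMILITUDE PARTNER: `(e a)_w = diag(1,u)·a_w·diag(1,u)⁻¹` in `U(σ_w, Φ₂,w)(L_w) ≤ GL₂(L_w)`,
# `u ∈ 𝒪_wˣ` `σ_w`-fixed and not a norm, and `Ad diag(1,u)` NORMALISES EVERY LEVEL of the ramified tree road — `GL₂(𝒪_w)`, its diagonal conjugates, the congruence subgroups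
# (Labesse–Langlands 1979 §2; Rogawski 1990 Lemma 4.9.3; road «R1-ram», architect A-p16 (g27) A-19 ∕ A-21, B-p12 (g29) MEMO (R5b-α) 06d3de01 (4))

Topic `NumberTheory/Rogawski1990`; namespace `Literature.NumberTheory.Rogawski1990`.  THEOREMS ONLY (no definition, no instance, no notation, no named fact, no `sorry`).
Cell `pub/hodgecm-mathlib` (D-0151), crux H413 = `stmt-HodgeConjecture-24833`, line «N6nsGerm» stub `stub_N6nsR1LL`, residue ★ `RankOneUnstableTransferNonsplitCMERamified` ⟸ ★ p843417
`…CMERamified_of_core` ⟸ the ramified core (R-5b).  HONEST LABEL: HC_CM is proved only modulo the printed citations (the 2 remaining named inputs hLiu418, h413) until rung 0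
closes; this file is unconditional local algebra.

WHY.  ★ p843548 types the ramified partner `e = (Ad T_r, id)`, `T_r = diag(1, r) ∈ GL₂(L ⊗ L⁺_v)`, in F0P2-p01's LocalRing currency (so ★ L1's sockets read one shape at every
non-split place).  The ramified depth expansion (R-2 A-p01, R-3 B-p12, (R5b-α) A-p13, (R5b-β) F0P3a-p03) lives in the ONE-PLACE model `U_w = U(σ_w, Φ₂,w)(L_w) ≤ GL₂(L_w)`
(★ `localNonsplitEquiv`): lattices, the edge stabiliser `K = GL₂(𝒪_w) ∩ U_w`, the vertex stabiliser `K♯ = D_η K D_η⁻¹ ∩ U_w`, the congruence levels `K(m)`.  B-p12's MEMO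
(R5b-α) (4): «`Fix(Ad_h t) = h·Fix(t)`, types and depths preserved (`h = diag(1,u)`, `u` a unit), the class at `hΛ` is the class at `Λ` conjugated by `diag(1,u)` ⇒ every bit
flips, nothing else moves».  This file is the dictionary: `(e a)_w = D_u · a_w · D_u⁻¹` with `D_u = diag(1, u) ∈ GL₂(𝒪_w)`, `u = r_w`, and `D_u` normalises every level `S` of
the road.

WHAT IS PROVED (`L` CM, `w ∣ v` non-split, `σ_w = galAdicCompletionMap c hw`, `E_w := localNonsplitEquiv c Φ₂ hc w hw : U(Φ₂)(L⁺_v) ≃ₜ* U_w`):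
* §1 `coe_localNonsplitEquiv_cmDatumLocalCongr` — for ANY LocalRing similitude `T`: `E_w(T g T⁻¹) = T_w · E_w(g) · T_w⁻¹` (`T_w = localGLPiEquiv T w`; generic `N`, `H`, `H′`);
  `localGLPiEquiv_glDiagonal` — `(diag d)_w = diag(d_w)`.
* §2 `conj_mem_valuedCongruenceSubgroup_iff` (`GL_n(𝒪)` normalises every valued congruence subgroup), `glDiagonal_one_unit_mem_valuedCongruenceSubgroup_one` ∕ `…_mem_glInt`
  (`D_u ∈ GL₂(𝒪_w)`), and the LEVEL-FAMILY instances `conj_glDiagonal_one_unit_mem_valuedCongruenceSubgroup_iff` (`K(m)`), `conj_glDiagonal_one_unit_mem_glInt_iff` (`GL₂(𝒪_w)`),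
  `conj_glDiagonal_mem_map_conj_glDiagonal_iff` (`D_η S D_η⁻¹` for any diagonal `D_η`: `K♯`, `D_η K(m) D_η⁻¹`).
* §3 THE ONE-PLACE PACKAGE **`exists_unitSimilitudePartner_onePlace_of_ramified`** (`(w hw he)`) ∕ **`…_of_not_isUnramifiedIn`** (`(hv hram)`, the letter's binders): `∃ r hru (u : L_wˣ)
  (e : H_v ≃ₜ* H_v)` with ALL of ★ p843548's clauses (LocalRing formula, `hτP`-frame, `hτst`, `e K_H = K_H`, `MeasurePreserving e ν ν`) AND `↑u = r_w`, `|u|_w = 1`, `σ_w u = u`,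
  `u ≠ σ_w(z)·z` for all `z ∈ L_w`, `E_w((e a).1) = D_u · E_w(a.1) · D_u⁻¹`, `D_u ∈ GL₂(𝒪_w)`, and `∀ S ≤ GL₂(L_w)` normalised by `D_u`: `E_w((e a).1) ∈ S ↔ E_w(a.1) ∈ S`.

## References
* [LabesseLanglands1979] J.-P. Labesse, R. P. Langlands, *L-indistinguishability for SL(2)*, Canad. J. Math. 31 (1979): §2 pp. 8–10.
* [Rogawski1990] J. D. Rogawski, *Automorphic Representations of Unitary Groups in Three Variables*, Ann. of Math. Stud. 123 (1990): §3.6 pp. 31–32, §4.9 Lemma 4.9.3 p. 56.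
* [PlatonovRapinchuk1994] V. Platonov, A. Rapinchuk, *Algebraic Groups and Number Theory* (1994): §2.3, §5.1.
* [BushnellHenniart2006] C. J. Bushnell, G. Henniart, *The Local Langlands Conjecture for GL(2)* (2006): §1.1 (congruence subgroups of `GL_n(𝒪)`).
-/

set_option autoImplicit false

noncomputable section

open Set Filter Topology MeasureTheory NumberField IsDedekindDomain Matrix
open scoped MatrixGroups

namespace Literature.NumberTheory.Rogawski1990

open Literature.NumberTheory.Automorphic Literature.NumberTheory.Automorphic.UnitaryGroup Literature.NumberTheory.GaloisRepresentations

/-! ## §1 The one-place model reads LocalRing conjugation as conjugation -/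

section Bridge

variable (L : Type) [Field L] [NumberField L] [IsCMField L] (N : ℕ) {v : HeightOneSpectrum (𝓞 ↥(maximalRealSubfield L))}
  (w : PlacesOver L v) (hw : IsCMField.complexConj L • w.1 = w.1)

/-- The one-place model of `U(H)(L⁺_v)` IS evaluation at `w`: `E_w(g) = g_w` in `GL_N(L_w)` (definitional). [cite: PlatonovRapinchuk1994, §5.1] -/
theorem coe_localNonsplitEquiv_eq_localGLPiEquiv (H : Matrix (Fin N) (Fin N) L) (g : (cmDatum L N H).Local v) :
    ((localNonsplitEquiv (IsCMField.complexConj L) H (IsCMField.complexConj_ne_one L) w hw g :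
        ↥(unitaryGroupOfForm (galAdicCompletionMap (L := L) (IsCMField.complexConj L) hw) (placeForm H w.1))) : GL (Fin N) (w.1.adicCompletion L)) =
      localGLPiEquiv L N v (g.val : GL (Fin N) (LocalRing L v)) w := rfl

/-- **`E_w(T g T⁻¹) = T_w · E_w(g) · T_w⁻¹`**: the one-place model reads the LocalRing similitude transport ★ `cmDatumLocalCongr L v T ha h` (`g ↦ T g T⁻¹`, `T ∈ GL_N(L ⊗ L⁺_v)`)
as conjugation by the `w`-component `T_w = localGLPiEquiv T w ∈ GL_N(L_w)`. [cite: PlatonovRapinchuk1994, §2.3, §5.1] -/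
theorem coe_localNonsplitEquiv_cmDatumLocalCongr {H H' : Matrix (Fin N) (Fin N) L} (T : GL (Fin N) (LocalRing L v)) {a : LocalRing L v} (ha : IsUnit a)
    (h : formCongr (conjLocal L (IsCMField.complexConj L) v) T (H.map (algebraMap L (LocalRing L v))) = a • H'.map (algebraMap L (LocalRing L v)))
    (g : (cmDatum L N H').Local v) :
    ((localNonsplitEquiv (IsCMField.complexConj L) H (IsCMField.complexConj_ne_one L) w hw (cmDatumLocalCongr L v T ha h g) :
        ↥(unitaryGroupOfForm (galAdicCompletionMap (L := L) (IsCMField.complexConj L) hw) (placeForm H w.1))) : GL (Fin N) (w.1.adicCompletion L)) =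
      localGLPiEquiv L N v T w *
        ((localNonsplitEquiv (IsCMField.complexConj L) H' (IsCMField.complexConj_ne_one L) w hw g :
          ↥(unitaryGroupOfForm (galAdicCompletionMap (L := L) (IsCMField.complexConj L) hw) (placeForm H' w.1))) : GL (Fin N) (w.1.adicCompletion L)) *
        (localGLPiEquiv L N v T w)⁻¹ := by
  rw [coe_localNonsplitEquiv_eq_localGLPiEquiv, coe_localNonsplitEquiv_eq_localGLPiEquiv, coe_cmDatumLocalCongr_apply, map_mul, map_mul, map_inv,
    Pi.mul_apply, Pi.mul_apply, Pi.inv_apply]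

omit [IsCMField L] in
/-- `(diag d)_w = diag(d_w)`: the `w`-component of a LocalRing diagonal matrix. [cite: PlatonovRapinchuk1994, §5.1] -/
theorem localGLPiEquiv_glDiagonal (n : ℕ) (d : Fin n → (LocalRing L v)ˣ) :
    localGLPiEquiv L n v (glDiagonal n (LocalRing L v) d) w =
      glDiagonal n (w.1.adicCompletion L) (fun i => Units.map (Pi.evalRingHom (fun w' : PlacesOver L v => w'.1.adicCompletion L) w : LocalRing L v →+* w.1.adicCompletion L).toMonoidHom (d i)) := by
  apply Units.ext
  ext i j
  rw [localGLPiEquiv_apply_apply, coe_glDiagonal, coe_glDiagonal, Matrix.diagonal_apply, Matrix.diagonal_apply]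
  split_ifs <;> rfl

omit [IsCMField L] in
/-- … for `n = 2`, `d = ![1, r]`: `(diag(1, r))_w = diag(1, r_w)`. [cite: PlatonovRapinchuk1994, §5.1] -/
theorem localGLPiEquiv_glDiagonal_one_unit {r : LocalRing L v} (hru : IsUnit r) :
    localGLPiEquiv L 2 v (glDiagonal 2 (LocalRing L v) ![1, hru.unit]) w =
      glDiagonal 2 (w.1.adicCompletion L) ![1, Units.map (Pi.evalRingHom (fun w' : PlacesOver L v => w'.1.adicCompletion L) w : LocalRing L v →+* w.1.adicCompletion L).toMonoidHom hru.unit] := by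
  rw [localGLPiEquiv_glDiagonal]
  congr 1
  funext i
  fin_cases i
  · exact Units.ext rfl
  · rfl

end Bridge

/-! ## §2 Level family: a diagonal integral unit normalises `GL₂(𝒪_w)`, its diagonal conjugates, and the congruence subgroups -/

section Levels

variable {G : Type*} [Group G]

/-- A subgroup is normalised by its own elements: `D ∈ S ⇒ (D s D⁻¹ ∈ S ↔ s ∈ S)`. [folklore] -/
private theorem conj_mem_iff_of_mem₁₄ {S : Subgroup G} {D : G} (hD : D ∈ S) (s : G) : D * s * D⁻¹ ∈ S ↔ s ∈ S := by
  rw [Subgroup.mul_mem_cancel_right S (inv_mem hD), Subgroup.mul_mem_cancel_left S hD]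

/-- If `D` normalises `S` and commutes with `D′`, then `D` normalises `D′ S D′⁻¹`. [folklore] -/
private theorem conj_mem_map_conj_iff_of_commute₁₄ {S : Subgroup G} {D D' : G} (hS : ∀ s, D * s * D⁻¹ ∈ S ↔ s ∈ S) (hc : Commute D D') (s : G) :
    D * s * D⁻¹ ∈ S.map (MulAut.conj D').toMonoidHom ↔ s ∈ S.map (MulAut.conj D').toMonoidHom := by
  rw [Subgroup.mem_map_equiv, Subgroup.mem_map_equiv, MulAut.conj_symm_apply, MulAut.conj_symm_apply]
  have hci : Commute D'⁻¹ D := (hc.inv_right).symm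
  have key : D'⁻¹ * (D * s * D⁻¹) * D' = D * (D'⁻¹ * s * D') * D⁻¹ := by
    calc D'⁻¹ * (D * s * D⁻¹) * D' = (D'⁻¹ * D) * s * (D⁻¹ * D') := by group
      _ = (D * D'⁻¹) * s * (D' * D⁻¹) := by rw [hci.eq, hc.inv_left.eq]
      _ = D * (D'⁻¹ * s * D') * D⁻¹ := by group
  rw [key, hS]

variable {F : Type*} [Field F] {Γ₀ : Type*} [LinearOrderedCommGroupWithZero Γ₀] [Valued F Γ₀] {n : ℕ}

/-- **`GL_n(𝒪)` normalises every valued congruence subgroup of radius `r ≤ 1`**: for `k` of radius `1` and `u` of radius `r`, `k⁻¹ u k` has radius `r`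
(`k⁻¹ u k − 1 = k⁻¹ (u − 1) k`, ultrametric inequality; local copy of ★ `inv_mul_mul_mem_valuedCongruenceSubgroup`). [cite: BushnellHenniart2006, §1.1] -/
private theorem inv_mul_mul_mem_valuedCongruenceSubgroup₁₄ {k u : GL (Fin n) F} {r : Γ₀}
    (hk : k ∈ valuedCongruenceSubgroup (Fin n) (1 : Γ₀)) (hu : u ∈ valuedCongruenceSubgroup (Fin n) r) :
    k⁻¹ * u * k ∈ valuedCongruenceSubgroup (Fin n) r := by
  obtain ⟨hk₁, hk₂, -⟩ := hk
  obtain ⟨hu₁, hu₂, hu₃⟩ := hu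
  refine ⟨fun a b => ?_, fun a b => ?_, fun a b => ?_⟩
  · rw [Units.val_mul, Units.val_mul]
    simpa using valued_mul_apply_le (Fin n) (valued_mul_apply_le (Fin n) hk₂ hu₁) hk₁ a b
  · rw [_root_.mul_inv_rev, _root_.mul_inv_rev, inv_inv, ← mul_assoc, Units.val_mul, Units.val_mul]
    simpa using valued_mul_apply_le (Fin n) (valued_mul_apply_le (Fin n) hk₂ hu₂) hk₁ a b
  · have e : ((k⁻¹ * u * k : GL (Fin n) F) : Matrix (Fin n) (Fin n) F) - 1 =
        ((k⁻¹ : GL (Fin n) F) : Matrix (Fin n) (Fin n) F) * ((u : Matrix (Fin n) (Fin n) F) - 1) * (k : Matrix (Fin n) (Fin n) F) := by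
      rw [Units.val_mul, Units.val_mul, Matrix.mul_sub, Matrix.sub_mul, Matrix.mul_one, Units.inv_mul]
    rw [e]
    simpa using valued_mul_apply_le (Fin n) (valued_mul_apply_le (Fin n) hk₂ hu₃) hk₁ a b

/-- **… as an `iff`**: for `D ∈ GL_n(𝒪)` (radius `1`) and ANY radius `r`: `D s D⁻¹ ∈ K(r) ↔ s ∈ K(r)`. [cite: BushnellHenniart2006, §1.1] -/
theorem conj_mem_valuedCongruenceSubgroup_iff {D : GL (Fin n) F} (hD : D ∈ valuedCongruenceSubgroup (Fin n) (1 : Γ₀)) (r : Γ₀) (s : GL (Fin n) F) :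
    D * s * D⁻¹ ∈ valuedCongruenceSubgroup (Fin n) r ↔ s ∈ valuedCongruenceSubgroup (Fin n) r := by
  constructor
  · intro h
    have h' := inv_mul_mul_mem_valuedCongruenceSubgroup₁₄ hD h
    rwa [show D⁻¹ * (D * s * D⁻¹) * D = s by group] at h'
  · intro h
    have h' := inv_mul_mul_mem_valuedCongruenceSubgroup₁₄ (inv_mem hD) h
    rwa [inv_inv] at h'

/-- **`diag(1, u) ∈ GL₂(𝒪)`** (radius-`1` valued congruence subgroup) for a unit `u` with `|u| = 1`. [cite: PlatonovRapinchuk1994, §5.1] -/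
theorem glDiagonal_one_unit_mem_valuedCongruenceSubgroup_one (u : Fˣ) (hu : Valued.v (u : F) = 1) :
    glDiagonal 2 F ![1, u] ∈ valuedCongruenceSubgroup (Fin 2) (1 : Γ₀) := by
  have hd : ∀ i : Fin 2, Valued.v ((![(1 : Fˣ), u] i : Fˣ) : F) ≤ 1 := by
    intro i; fin_cases i
    · simp
    · exact hu.le
  have hdi : ∀ i : Fin 2, Valued.v (((![(1 : Fˣ), u] i)⁻¹ : Fˣ) : F) ≤ 1 := by
    intro i; fin_cases i
    · simp
    · have h : Valued.v ((u : Fˣ) : F) * Valued.v ((u⁻¹ : Fˣ) : F) = 1 := by rw [← map_mul, Units.mul_inv, map_one]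
      rw [hu, one_mul] at h
      exact h.le
  refine (mem_valuedCongruenceSubgroup_iff (m := Fin 2)).2 ⟨fun i j => ?_, fun i j => ?_, fun i j => ?_⟩
  · rw [coe_glDiagonal, Matrix.diagonal_apply]
    split_ifs
    · exact hd i
    · rw [map_zero]; exact zero_le
  · rw [← map_inv, coe_glDiagonal, Matrix.diagonal_apply]
    split_ifs
    · rw [Pi.inv_apply]; exact hdi i
    · rw [map_zero]; exact zero_le
  · rw [coe_glDiagonal, ← Matrix.diagonal_one, Matrix.diagonal_sub, Matrix.diagonal_apply]
    split_ifs
    · exact Valued.v.map_sub_le (hd i) (by rw [map_one])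
    · rw [map_zero]; exact zero_le

/-- Diagonal matrices commute. [folklore] -/
private theorem glDiagonal_commute₁₄ {R : Type*} [CommRing R] (d d' : Fin n → Rˣ) : Commute (glDiagonal n R d) (glDiagonal n R d') := by
  change glDiagonal n R d * glDiagonal n R d' = glDiagonal n R d' * glDiagonal n R d
  rw [← map_mul, ← map_mul, mul_comm]

/-- **LEVEL FAMILY (congruence levels): `D_u = diag(1, u)`, `|u| = 1`, normalises EVERY valued congruence subgroup** `K(r) = {g ∈ GL₂(𝒪) : g ≡ 1 mod radius r}`
(any `r`; `r = exp(−m)` is the principal congruence subgroup `K(m)` of the road): `D_u s D_u⁻¹ ∈ K(r) ↔ s ∈ K(r)`. [cite: PlatonovRapinchuk1994, §3.3, §5.1] -/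
theorem conj_glDiagonal_one_unit_mem_valuedCongruenceSubgroup_iff (u : Fˣ) (hu : Valued.v (u : F) = 1) (r : Γ₀) (s : GL (Fin 2) F) :
    glDiagonal 2 F ![1, u] * s * (glDiagonal 2 F ![1, u])⁻¹ ∈ valuedCongruenceSubgroup (Fin 2) r ↔ s ∈ valuedCongruenceSubgroup (Fin 2) r :=
  conj_mem_valuedCongruenceSubgroup_iff (glDiagonal_one_unit_mem_valuedCongruenceSubgroup_one u hu) r s

/-- **LEVEL FAMILY (diagonal conjugates): if `D_u` normalises `S` then it normalises `D′ S D′⁻¹` for EVERY diagonal `D′ = diag(d′)`** (diagonal matrices commute) — the vertex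
stabiliser `K♯ = D_η GL₂(𝒪_w) D_η⁻¹` and its congruence levels `D_η K(m) D_η⁻¹` of the ramified tree road. [cite: PlatonovRapinchuk1994, §3.3, §5.1] -/
theorem conj_glDiagonal_mem_map_conj_glDiagonal_iff {R : Type*} [CommRing R] (d : Fin 2 → Rˣ) {S : Subgroup (GL (Fin 2) R)}
    (hS : ∀ s, glDiagonal 2 R d * s * (glDiagonal 2 R d)⁻¹ ∈ S ↔ s ∈ S) (d' : Fin 2 → Rˣ) (s : GL (Fin 2) R) :
    glDiagonal 2 R d * s * (glDiagonal 2 R d)⁻¹ ∈ S.map (MulAut.conj (glDiagonal 2 R d')).toMonoidHom ↔ s ∈ S.map (MulAut.conj (glDiagonal 2 R d')).toMonoidHom :=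
  conj_mem_map_conj_iff_of_commute₁₄ hS (glDiagonal_commute₁₄ d d') s

end Levels

/-! ## §3 THE ONE-PLACE PACKAGE of the ramified unit similitude partner -/

section Package

variable (L : Type) [Field L] [NumberField L] [IsCMField L] (v : HeightOneSpectrum (𝓞 ↥(maximalRealSubfield L)))

omit [IsCMField L] in
/-- `diag(1, u) ∈ GL₂(𝒪_w)` (the tree's `glInt`) for `|u|_w = 1` (★ `mem_glInt_iff_forall_v_le_one`). [cite: PlatonovRapinchuk1994, §5.1] -/
theorem glDiagonal_one_unit_mem_glInt (w : PlacesOver L v) (u : (w.1.adicCompletion L)ˣ) (hu : Valued.v (u : w.1.adicCompletion L) = 1) :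
    glDiagonal 2 (w.1.adicCompletion L) ![1, u] ∈ glInt 2 (w.1.adicCompletion L) := by
  obtain ⟨h1, h2, -⟩ := glDiagonal_one_unit_mem_valuedCongruenceSubgroup_one (Γ₀ := WithZero (Multiplicative ℤ)) u hu
  exact (Literature.NumberTheory.Automorphic.mem_glInt_iff_forall_v_le_one _).2 ⟨h1, h2⟩

omit [IsCMField L] in
/-- **LEVEL FAMILY (the edge stabiliser): `D_u = diag(1, u)`, `|u|_w = 1`, normalises `GL₂(𝒪_w)`** (`D_u ∈ GL₂(𝒪_w)`): `D_u s D_u⁻¹ ∈ GL₂(𝒪_w) ↔ s ∈ GL₂(𝒪_w)` — with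
`conj_glDiagonal_mem_map_conj_glDiagonal_iff` also `K♯ = D_η GL₂(𝒪_w) D_η⁻¹`. [cite: PlatonovRapinchuk1994, §3.3, §5.1] -/
theorem conj_glDiagonal_one_unit_mem_glInt_iff (w : PlacesOver L v) (u : (w.1.adicCompletion L)ˣ) (hu : Valued.v (u : w.1.adicCompletion L) = 1)
    (s : GL (Fin 2) (w.1.adicCompletion L)) :
    glDiagonal 2 (w.1.adicCompletion L) ![1, u] * s * (glDiagonal 2 (w.1.adicCompletion L) ![1, u])⁻¹ ∈ glInt 2 (w.1.adicCompletion L) ↔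
      s ∈ glInt 2 (w.1.adicCompletion L) :=
  conj_mem_iff_of_mem₁₄ (glDiagonal_one_unit_mem_glInt L v w u hu) s

/-- **THE ONE-PLACE PACKAGE (R-0b).**  At a RAMIFIED non-split `w ∣ v` (`e(w|v) ≠ 1`), for an elliptic regular frame `(t₀, P, d)` of `H_v = U(Φ₂)(L⁺_v) × U(Φ₁)(L⁺_v)`: there are
a `σ`-fixed INTEGRAL unit `r ∈ L ⊗ L⁺_v` which is not a norm, its `w`-component `u = r_w ∈ L_wˣ`, and the partner `e = (Ad diag(1,r), id) : H_v ≃ₜ* H_v` of ★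
`exists_unitSimilitudePartner_of_ramified` with ALL its clauses (LocalRing formula, frame `(e t).1·(T_r P) = (T_r P)·diag(τ₀ t, τ₁ t)`, `hτst`, `e K_H = K_H`, Haar), PLUS the
one-place reading: `|u|_w = 1`, `σ_w u = u`, `u ≠ σ_w(z)·z` for every `z ∈ L_w`, **`E_w((e a).1) = D_u · E_w(a.1) · D_u⁻¹`** with `D_u = diag(1, u) ∈ GL₂(𝒪_w)`, and the LEVEL
FAMILY: for every `S ≤ GL₂(L_w)` normalised by `D_u` (§2: `GL₂(𝒪_w)`, `D_η GL₂(𝒪_w) D_η⁻¹`, `K(m)`, `D_η K(m) D_η⁻¹`, …), `E_w((e a).1) ∈ S ↔ E_w(a.1) ∈ S` — B-p12's MEMO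
(R5b-α) (4) «`Ad_h` preserves types and depths, flips the bit». [cite: LabesseLanglands1979, §2 pp. 8–10] [cite: Rogawski1990, §3.6 pp. 31–32; §4.9 Lemma 4.9.3 p. 56]
[cite: PlatonovRapinchuk1994, §2.3, §5.1] -/
theorem exists_unitSimilitudePartner_onePlace_of_ramified (w : PlacesOver L v) (hw : IsCMField.complexConj L • w.1 = w.1)
    (he : v.asIdeal.ramificationIdx' w.1.asIdeal ≠ 1) [MeasurableSpace ((cmDatum L 2 (Matrix.of fun i j : Fin 2 => if i.val + j.val + 1 = 2 then (1 : L) else 0)).Local v × (cmDatum L 1 (Matrix.of fun i j : Fin 1 => if i.val + j.val + 1 = 1 then (1 : L) else 0)).Local v)] [BorelSpace ((cmDatum L 2 (Matrix.of fun i j : Fin 2 => if i.val + j.val + 1 = 2 then (1 : L) else 0)).Local v × (cmDatum L 1 (Matrix.of fun i j : Fin 1 => if i.val + j.val + 1 = 1 then (1 : L) else 0)).Local v)]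
    (t₀ : ((cmDatum L 2 (Matrix.of fun i j : Fin 2 => if i.val + j.val + 1 = 2 then (1 : L) else 0)).Local v × (cmDatum L 1 (Matrix.of fun i j : Fin 1 => if i.val + j.val + 1 = 1 then (1 : L) else 0)).Local v)) (P : GL (Fin 2) (LocalRing L v)) (d : Fin 2 → (LocalRing L v)) (ht₀ : IsRegularElt (t₀.1.val : GL (Fin 2) (LocalRing L v)))
    (hP : (t₀.1.val.val : Matrix (Fin 2) (Fin 2) (LocalRing L v)) * P.val = P.val * Matrix.diagonal d) (hd1 : ∀ i, conjLocal L (IsCMField.complexConj L) v (d i) * d i = 1) :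
    ∃ (r : LocalRing L v) (hru : IsUnit r) (u : ((w.1.adicCompletion L))ˣ) (e : ((cmDatum L 2 (Matrix.of fun i j : Fin 2 => if i.val + j.val + 1 = 2 then (1 : L) else 0)).Local v × (cmDatum L 1 (Matrix.of fun i j : Fin 1 => if i.val + j.val + 1 = 1 then (1 : L) else 0)).Local v) ≃ₜ* ((cmDatum L 2 (Matrix.of fun i j : Fin 2 => if i.val + j.val + 1 = 2 then (1 : L) else 0)).Local v × (cmDatum L 1 (Matrix.of fun i j : Fin 1 => if i.val + j.val + 1 = 1 then (1 : L) else 0)).Local v)),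
      conjLocal L (IsCMField.complexConj L) v r = r ∧ (∀ w' : PlacesOver L v, Valued.v (r w') = 1) ∧
      (¬ ∃ z : LocalRing L v, IsUnit z ∧ r = conjLocal L (IsCMField.complexConj L) v z * z) ∧
      (∀ a : ((cmDatum L 2 (Matrix.of fun i j : Fin 2 => if i.val + j.val + 1 = 2 then (1 : L) else 0)).Local v × (cmDatum L 1 (Matrix.of fun i j : Fin 1 => if i.val + j.val + 1 = 1 then (1 : L) else 0)).Local v), ((e a).1.val : GL (Fin 2) (LocalRing L v)) = glDiagonal 2 (LocalRing L v) ![1, hru.unit] * a.1.val * (glDiagonal 2 (LocalRing L v) ![1, hru.unit])⁻¹ ∧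
        (e a).2 = a.2) ∧
      (∀ t : ↥(Subgroup.centralizer ({t₀} : Set ((cmDatum L 2 (Matrix.of fun i j : Fin 2 => if i.val + j.val + 1 = 2 then (1 : L) else 0)).Local v × (cmDatum L 1 (Matrix.of fun i j : Fin 1 => if i.val + j.val + 1 = 1 then (1 : L) else 0)).Local v))), ((e (t : ((cmDatum L 2 (Matrix.of fun i j : Fin 2 => if i.val + j.val + 1 = 2 then (1 : L) else 0)).Local v × (cmDatum L 1 (Matrix.of fun i j : Fin 1 => if i.val + j.val + 1 = 1 then (1 : L) else 0)).Local v))).1.val.val : Matrix (Fin 2) (Fin 2) (LocalRing L v)) * (glDiagonal 2 (LocalRing L v) ![1, hru.unit] * P).val =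
        (glDiagonal 2 (LocalRing L v) ![1, hru.unit] * P).val * Matrix.diagonal ![((P⁻¹).val * ((t : ((cmDatum L 2 (Matrix.of fun i j : Fin 2 => if i.val + j.val + 1 = 2 then (1 : L) else 0)).Local v × (cmDatum L 1 (Matrix.of fun i j : Fin 1 => if i.val + j.val + 1 = 1 then (1 : L) else 0)).Local v)).1.val.val : Matrix (Fin 2) (Fin 2) (LocalRing L v)) * P.val) 0 0, ((P⁻¹).val * ((t : ((cmDatum L 2 (Matrix.of fun i j : Fin 2 => if i.val + j.val + 1 = 2 then (1 : L) else 0)).Local v × (cmDatum L 1 (Matrix.of fun i j : Fin 1 => if i.val + j.val + 1 = 1 then (1 : L) else 0)).Local v)).1.val.val : Matrix (Fin 2) (Fin 2) (LocalRing L v)) * P.val) 1 1]) ∧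
      (∀ t : ↥(Subgroup.centralizer ({t₀} : Set ((cmDatum L 2 (Matrix.of fun i j : Fin 2 => if i.val + j.val + 1 = 2 then (1 : L) else 0)).Local v × (cmDatum L 1 (Matrix.of fun i j : Fin 1 => if i.val + j.val + 1 = 1 then (1 : L) else 0)).Local v))), IsRegularElt ((t : ((cmDatum L 2 (Matrix.of fun i j : Fin 2 => if i.val + j.val + 1 = 2 then (1 : L) else 0)).Local v × (cmDatum L 1 (Matrix.of fun i j : Fin 1 => if i.val + j.val + 1 = 1 then (1 : L) else 0)).Local v)).1.val : GL (Fin 2) (LocalRing L v)) →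
        IsLocalStablyConjH L v (t : ((cmDatum L 2 (Matrix.of fun i j : Fin 2 => if i.val + j.val + 1 = 2 then (1 : L) else 0)).Local v × (cmDatum L 1 (Matrix.of fun i j : Fin 1 => if i.val + j.val + 1 = 1 then (1 : L) else 0)).Local v)) (e (t : ((cmDatum L 2 (Matrix.of fun i j : Fin 2 => if i.val + j.val + 1 = 2 then (1 : L) else 0)).Local v × (cmDatum L 1 (Matrix.of fun i j : Fin 1 => if i.val + j.val + 1 = 1 then (1 : L) else 0)).Local v))) ∧ ¬ IsConj (t : ((cmDatum L 2 (Matrix.of fun i j : Fin 2 => if i.val + j.val + 1 = 2 then (1 : L) else 0)).Local v × (cmDatum L 1 (Matrix.of fun i j : Fin 1 => if i.val + j.val + 1 = 1 then (1 : L) else 0)).Local v)) (e (t : ((cmDatum L 2 (Matrix.of fun i j : Fin 2 => if i.val + j.val + 1 = 2 then (1 : L) else 0)).Local v × (cmDatum L 1 (Matrix.of fun i j : Fin 1 => if i.val + j.val + 1 = 1 then (1 : L) else 0)).Local v)))) ∧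
      (∀ a : ((cmDatum L 2 (Matrix.of fun i j : Fin 2 => if i.val + j.val + 1 = 2 then (1 : L) else 0)).Local v × (cmDatum L 1 (Matrix.of fun i j : Fin 1 => if i.val + j.val + 1 = 1 then (1 : L) else 0)).Local v), e a ∈ ((cmLocalIntegralLevel L 2 (Matrix.of fun i j : Fin 2 => if i.val + j.val + 1 = 2 then (1 : L) else 0) v).prod (cmLocalIntegralLevel L 1 (Matrix.of fun i j : Fin 1 => if i.val + j.val + 1 = 1 then (1 : L) else 0) v) : Subgroup ((cmDatum L 2 (Matrix.of fun i j : Fin 2 => if i.val + j.val + 1 = 2 then (1 : L) else 0)).Local v × (cmDatum L 1 (Matrix.of fun i j : Fin 1 => if i.val + j.val + 1 = 1 then (1 : L) else 0)).Local v)) ↔ a ∈ ((cmLocalIntegralLevel L 2 (Matrix.of fun i j : Fin 2 => if i.val + j.val + 1 = 2 then (1 : L) else 0) v).prod (cmLocalIntegralLevel L 1 (Matrix.of fun i j : Fin 1 => if i.val + j.val + 1 = 1 then (1 : L) else 0) v) : Subgroup ((cmDatum L 2 (Matrix.of fun i j : Fin 2 => if i.val + j.val + 1 = 2 then (1 : L)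 else 0)).Local v × (cmDatum L 1 (Matrix.of fun i j : Fin 1 => if i.val + j.val + 1 = 1 then (1 : L) else 0)).Local v))) ∧
      (∀ (ν : Measure ((cmDatum L 2 (Matrix.of fun i j : Fin 2 => if i.val + j.val + 1 = 2 then (1 : L) else 0)).Local v × (cmDatum L 1 (Matrix.of fun i j : Fin 1 => if i.val + j.val + 1 = 1 then (1 : L) else 0)).Local v)) [ν.IsHaarMeasure], MeasurePreserving e ν ν) ∧
      (u : (w.1.adicCompletion L)) = r w ∧ Valued.v (u : (w.1.adicCompletion L)) = 1 ∧ (galAdicCompletionMap (L := L) (IsCMField.complexConj L) hw) u = u ∧ (¬ ∃ z : (w.1.adicCompletion L), (u : (w.1.adicCompletion L)) = (galAdicCompletionMap (L := L) (IsCMField.complexConj L) hw) z * z) ∧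
      (∀ a : ((cmDatum L 2 (Matrix.of fun i j : Fin 2 => if i.val + j.val + 1 = 2 then (1 : L) else 0)).Local v × (cmDatum L 1 (Matrix.of fun i j : Fin 1 => if i.val + j.val + 1 = 1 then (1 : L) else 0)).Local v), (((localNonsplitEquiv (IsCMField.complexConj L) (Matrix.of fun i j : Fin 2 => if i.val + j.val + 1 = 2 then (1 : L) else 0) (IsCMField.complexConj_ne_one L) w hw) (e a).1 : ↥(unitaryGroupOfForm (galAdicCompletionMap (L := L) (IsCMField.complexConj L) hw) (placeForm (Matrix.of fun i j : Fin 2 => if i.val + j.val + 1 = 2 then (1 : L) else 0) w.1))) : GL (Fin 2) (w.1.adicCompletion L)) =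
        glDiagonal 2 (w.1.adicCompletion L) ![1, u] * (((localNonsplitEquiv (IsCMField.complexConj L) (Matrix.of fun i j : Fin 2 => if i.val + j.val + 1 = 2 then (1 : L) else 0) (IsCMField.complexConj_ne_one L) w hw) a.1 : ↥(unitaryGroupOfForm (galAdicCompletionMap (L := L) (IsCMField.complexConj L) hw) (placeForm (Matrix.of fun i j : Fin 2 => if i.val + j.val + 1 = 2 then (1 : L) else 0) w.1))) : GL (Fin 2) (w.1.adicCompletion L)) * (glDiagonal 2 (w.1.adicCompletion L) ![1, u])⁻¹) ∧
      glDiagonal 2 (w.1.adicCompletion L) ![1, u] ∈ glInt 2 (w.1.adicCompletion L) ∧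
      ∀ S : Subgroup (GL (Fin 2) (w.1.adicCompletion L)), (∀ s, glDiagonal 2 (w.1.adicCompletion L) ![1, u] * s * (glDiagonal 2 (w.1.adicCompletion L) ![1, u])⁻¹ ∈ S ↔ s ∈ S) →
        ∀ a : ((cmDatum L 2 (Matrix.of fun i j : Fin 2 => if i.val + j.val + 1 = 2 then (1 : L) else 0)).Local v × (cmDatum L 1 (Matrix.of fun i j : Fin 1 => if i.val + j.val + 1 = 1 then (1 : L) else 0)).Local v), (((localNonsplitEquiv (IsCMField.complexConj L) (Matrix.of fun i j : Fin 2 => if i.val + j.val + 1 = 2 then (1 : L) else 0) (IsCMField.complexConj_ne_one L) w hw) (e a).1 : ↥(unitaryGroupOfForm (galAdicCompletionMap (L := L) (IsCMField.complexConj L) hw) (placeForm (Matrix.of fun i j : Fin 2 => if i.val + j.val + 1 = 2 then (1 : L) else 0) w.1))) : GL (Fin 2) (w.1.adicCompletion L)) ∈ S ↔ (((localNonsplitEquiv (IsCMField.complexConj L) (Matrix.of fun i j : Fin 2 => if i.val + j.val + 1 = 2 then (1 : L) else 0) (IsCMField.complexConj_ne_one L) w hw) a.1 : ↥(unitaryGroupOfForm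 (galAdicCompletionMap (L := L) (IsCMField.complexConj L) hw) (placeForm (Matrix.of fun i j : Fin 2 => if i.val + j.val + 1 = 2 then (1 : L) else 0) w.1))) : GL (Fin 2) (w.1.adicCompletion L)) ∈ S := by
  have hc1 : IsCMField.complexConj L ≠ 1 := IsCMField.complexConj_ne_one L
  haveI hsub : Subsingleton (PlacesOver L v) := PlacesOver.subsingleton_of_smul_eq (IsCMField.complexConj L) hc1 w hw
  obtain ⟨r, hru, e, hrσ, hrv, hrn, hAd, hframe, hest, hK, hν⟩ := exists_unitSimilitudePartner_of_ramified L v w hw he t₀ P d ht₀ hP hd1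
  set u : ((w.1.adicCompletion L))ˣ := Units.map (Pi.evalRingHom (fun w' : PlacesOver L v => w'.1.adicCompletion L) w : LocalRing L v →+* w.1.adicCompletion L).toMonoidHom hru.unit with hu_def
  have huval : (u : (w.1.adicCompletion L)) = r w := rfl
  have hDw : localGLPiEquiv L 2 v (glDiagonal 2 (LocalRing L v) ![1, hru.unit]) w = glDiagonal 2 (w.1.adicCompletion L) ![1, u] :=
    localGLPiEquiv_glDiagonal_one_unit L w hru
  -- the one-place conjugation formula
  have hconj : ∀ a : ((cmDatum L 2 (Matrix.of fun i j : Fin 2 => if i.val + j.val + 1 = 2 then (1 : L) else 0)).Local v × (cmDatum L 1 (Matrix.of fun i j : Fin 1 => if i.val + j.val + 1 = 1 then (1 : L) else 0)).Local v), (((localNonsplitEquiv (IsCMField.complexConj L) (Matrix.of fun i j : Fin 2 => if i.val + j.val + 1 = 2 then (1 : L) else 0) (IsCMField.complexConj_ne_one L) w hw) (e a).1 : ↥(unitaryGroupOfForm (galAdicCompletionMap (L := L) (IsCMField.complexConj L) hw) (placeForm (Matrix.of fun i j : Fin 2 => if i.val + j.val + 1 = 2 then (1 : L) else 0) w.1)))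 : GL (Fin 2) (w.1.adicCompletion L)) =
      glDiagonal 2 (w.1.adicCompletion L) ![1, u] * (((localNonsplitEquiv (IsCMField.complexConj L) (Matrix.of fun i j : Fin 2 => if i.val + j.val + 1 = 2 then (1 : L) else 0) (IsCMField.complexConj_ne_one L) w hw) a.1 : ↥(unitaryGroupOfForm (galAdicCompletionMap (L := L) (IsCMField.complexConj L) hw) (placeForm (Matrix.of fun i j : Fin 2 => if i.val + j.val + 1 = 2 then (1 : L) else 0) w.1))) : GL (Fin 2) (w.1.adicCompletion L)) * (glDiagonal 2 (w.1.adicCompletion L) ![1, u])⁻¹ := fun a => by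
    rw [coe_localNonsplitEquiv_eq_localGLPiEquiv, coe_localNonsplitEquiv_eq_localGLPiEquiv, (hAd a).1, map_mul, map_mul, map_inv,
      Pi.mul_apply, Pi.mul_apply, Pi.inv_apply, hDw]
  have hvu : Valued.v (u : (w.1.adicCompletion L)) = 1 := by rw [huval]; exact hrv w
  refine ⟨r, hru, u, e, hrσ, hrv, hrn, hAd, hframe, hest, hK, hν, huval, hvu, ?_, ?_, hconj, glDiagonal_one_unit_mem_glInt L v w u hvu,
    fun S hS a => by rw [hconj a]; exact hS _⟩
  · -- `σ_w u = u`
    rw [huval, ← conjLocal_apply_eq_of_smul_eq (IsCMField.complexConj L) hc1 v w hw r, hrσ]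
  · -- `u` is not a norm in `L_w`
    rintro ⟨z, hz⟩
    letI : Unique (PlacesOver L v) := uniqueOfSubsingleton w
    let π : LocalRing L v ≃+* (w.1.adicCompletion L) := RingEquiv.piUnique fun w' : PlacesOver L v => w'.1.adicCompletion L
    have hπ : ∀ x : LocalRing L v, π x = x w := fun _ => rfl
    have hz0 : z ≠ 0 := by
      rintro rfl
      rw [mul_zero] at hz
      rw [hz, map_zero] at hvu
      exact zero_ne_one hvu
    refine hrn ⟨π.symm z, ?_, ?_⟩
    · exact (IsUnit.mk0 z hz0).map π.symm
    · rw [LocalRing.eq_iff_apply_eq (IsCMField.complexConj L) hc1 w hw, Pi.mul_apply,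
        conjLocal_apply_eq_of_smul_eq (IsCMField.complexConj L) hc1 v w hw (π.symm z), ← hπ (π.symm z), RingEquiv.apply_symm_apply, ← huval]
      exact hz

/-- **THE SAME ONE-PLACE PACKAGE IN THE LETTER'S BINDERS `(hv) (hram)`** (★ p843417 `hcore_ram`): at the place `w` above `v` (conjugation-fixed, ramified by ★
`ramificationIdx'_ne_one_of_not_isUnramifiedIn`). [cite: LabesseLanglands1979, §2 pp. 8–10] [cite: Rogawski1990, §4.9 Lemma 4.9.3 p. 56] -/
theorem exists_unitSimilitudePartner_onePlace_of_not_isUnramifiedIn (hv : Subsingleton (PlacesOver L v)) (hram : ¬ Algebra.IsUnramifiedIn (𝓞 L) v.asIdeal)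
    (w : PlacesOver L v) (hw : IsCMField.complexConj L • w.1 = w.1) [MeasurableSpace ((cmDatum L 2 (Matrix.of fun i j : Fin 2 => if i.val + j.val + 1 = 2 then (1 : L) else 0)).Local v × (cmDatum L 1 (Matrix.of fun i j : Fin 1 => if i.val + j.val + 1 = 1 then (1 : L) else 0)).Local v)] [BorelSpace ((cmDatum L 2 (Matrix.of fun i j : Fin 2 => if i.val + j.val + 1 = 2 then (1 : L) else 0)).Local v × (cmDatum L 1 (Matrix.of fun i j : Fin 1 => if i.val + j.val + 1 = 1 then (1 : L) else 0)).Local v)]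
    (t₀ : ((cmDatum L 2 (Matrix.of fun i j : Fin 2 => if i.val + j.val + 1 = 2 then (1 : L) else 0)).Local v × (cmDatum L 1 (Matrix.of fun i j : Fin 1 => if i.val + j.val + 1 = 1 then (1 : L) else 0)).Local v)) (P : GL (Fin 2) (LocalRing L v)) (d : Fin 2 → (LocalRing L v)) (ht₀ : IsRegularElt (t₀.1.val : GL (Fin 2) (LocalRing L v)))
    (hP : (t₀.1.val.val : Matrix (Fin 2) (Fin 2) (LocalRing L v)) * P.val = P.val * Matrix.diagonal d) (hd1 : ∀ i, conjLocal L (IsCMField.complexConj L) v (d i) * d i = 1) :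
    ∃ (r : LocalRing L v) (hru : IsUnit r) (u : ((w.1.adicCompletion L))ˣ) (e : ((cmDatum L 2 (Matrix.of fun i j : Fin 2 => if i.val + j.val + 1 = 2 then (1 : L) else 0)).Local v × (cmDatum L 1 (Matrix.of fun i j : Fin 1 => if i.val + j.val + 1 = 1 then (1 : L) else 0)).Local v) ≃ₜ* ((cmDatum L 2 (Matrix.of fun i j : Fin 2 => if i.val + j.val + 1 = 2 then (1 : L) else 0)).Local v × (cmDatum L 1 (Matrix.of fun i j : Fin 1 => if i.val + j.val + 1 = 1 then (1 : L) else 0)).Local v)),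
      conjLocal L (IsCMField.complexConj L) v r = r ∧ (∀ w' : PlacesOver L v, Valued.v (r w') = 1) ∧
      (¬ ∃ z : LocalRing L v, IsUnit z ∧ r = conjLocal L (IsCMField.complexConj L) v z * z) ∧
      (∀ a : ((cmDatum L 2 (Matrix.of fun i j : Fin 2 => if i.val + j.val + 1 = 2 then (1 : L) else 0)).Local v × (cmDatum L 1 (Matrix.of fun i j : Fin 1 => if i.val + j.val + 1 = 1 then (1 : L) else 0)).Local v), ((e a).1.val : GL (Fin 2) (LocalRing L v)) = glDiagonal 2 (LocalRing L v) ![1, hru.unit] * a.1.val * (glDiagonal 2 (LocalRing L v) ![1, hru.unit])⁻¹ ∧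
        (e a).2 = a.2) ∧
      (∀ t : ↥(Subgroup.centralizer ({t₀} : Set ((cmDatum L 2 (Matrix.of fun i j : Fin 2 => if i.val + j.val + 1 = 2 then (1 : L) else 0)).Local v × (cmDatum L 1 (Matrix.of fun i j : Fin 1 => if i.val + j.val + 1 = 1 then (1 : L) else 0)).Local v))), ((e (t : ((cmDatum L 2 (Matrix.of fun i j : Fin 2 => if i.val + j.val + 1 = 2 then (1 : L) else 0)).Local v × (cmDatum L 1 (Matrix.of fun i j : Fin 1 => if i.val + j.val + 1 = 1 then (1 : L) else 0)).Local v))).1.val.val : Matrix (Fin 2) (Fin 2) (LocalRing L v)) * (glDiagonal 2 (LocalRing L v) ![1, hru.unit] * P).val =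
        (glDiagonal 2 (LocalRing L v) ![1, hru.unit] * P).val * Matrix.diagonal ![((P⁻¹).val * ((t : ((cmDatum L 2 (Matrix.of fun i j : Fin 2 => if i.val + j.val + 1 = 2 then (1 : L) else 0)).Local v × (cmDatum L 1 (Matrix.of fun i j : Fin 1 => if i.val + j.val + 1 = 1 then (1 : L) else 0)).Local v)).1.val.val : Matrix (Fin 2) (Fin 2) (LocalRing L v)) * P.val) 0 0, ((P⁻¹).val * ((t : ((cmDatum L 2 (Matrix.of fun i j : Fin 2 => if i.val + j.val + 1 = 2 then (1 : L) else 0)).Local v × (cmDatum L 1 (Matrix.of fun i j : Fin 1 => if i.val + j.val + 1 = 1 then (1 : L) else 0)).Local v)).1.val.val : Matrix (Fin 2) (Fin 2) (LocalRing L v)) * P.val) 1 1]) ∧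
      (∀ t : ↥(Subgroup.centralizer ({t₀} : Set ((cmDatum L 2 (Matrix.of fun i j : Fin 2 => if i.val + j.val + 1 = 2 then (1 : L) else 0)).Local v × (cmDatum L 1 (Matrix.of fun i j : Fin 1 => if i.val + j.val + 1 = 1 then (1 : L) else 0)).Local v))), IsRegularElt ((t : ((cmDatum L 2 (Matrix.of fun i j : Fin 2 => if i.val + j.val + 1 = 2 then (1 : L) else 0)).Local v × (cmDatum L 1 (Matrix.of fun i j : Fin 1 => if i.val + j.val + 1 = 1 then (1 : L) else 0)).Local v)).1.val : GL (Fin 2) (LocalRing L v)) →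
        IsLocalStablyConjH L v (t : ((cmDatum L 2 (Matrix.of fun i j : Fin 2 => if i.val + j.val + 1 = 2 then (1 : L) else 0)).Local v × (cmDatum L 1 (Matrix.of fun i j : Fin 1 => if i.val + j.val + 1 = 1 then (1 : L) else 0)).Local v)) (e (t : ((cmDatum L 2 (Matrix.of fun i j : Fin 2 => if i.val + j.val + 1 = 2 then (1 : L) else 0)).Local v × (cmDatum L 1 (Matrix.of fun i j : Fin 1 => if i.val + j.val + 1 = 1 then (1 : L) else 0)).Local v))) ∧ ¬ IsConj (t : ((cmDatum L 2 (Matrix.of fun i j : Fin 2 => if i.val + j.val + 1 = 2 then (1 : L) else 0)).Local v × (cmDatum L 1 (Matrix.of fun i j : Fin 1 => if i.val + j.val + 1 = 1 then (1 : L) else 0)).Local v)) (e (t : ((cmDatum L 2 (Matrix.of fun i j : Fin 2 => if i.val + j.val + 1 = 2 then (1 : L) else 0)).Local v × (cmDatum L 1 (Matrix.of fun i j : Fin 1 => if i.val + j.val + 1 = 1 then (1 : L) else 0)).Local v)))) ∧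
      (∀ a : ((cmDatum L 2 (Matrix.of fun i j : Fin 2 => if i.val + j.val + 1 = 2 then (1 : L) else 0)).Local v × (cmDatum L 1 (Matrix.of fun i j : Fin 1 => if i.val + j.val + 1 = 1 then (1 : L) else 0)).Local v), e a ∈ ((cmLocalIntegralLevel L 2 (Matrix.of fun i j : Fin 2 => if i.val + j.val + 1 = 2 then (1 : L) else 0) v).prod (cmLocalIntegralLevel L 1 (Matrix.of fun i j : Fin 1 => if i.val + j.val + 1 = 1 then (1 : L) else 0) v) : Subgroup ((cmDatum L 2 (Matrix.of fun i j : Fin 2 => if i.val + j.val + 1 = 2 then (1 : L) else 0)).Local v × (cmDatum L 1 (Matrix.of fun i j : Fin 1 => if i.val + j.val + 1 = 1 then (1 : L) else 0)).Local v)) ↔ a ∈ ((cmLocalIntegralLevel L 2 (Matrix.of fun i j : Fin 2 => if i.val + j.val + 1 = 2 then (1 : L) else 0) v).prod (cmLocalIntegralLevel L 1 (Matrix.of fun i j : Fin 1 => if i.val + j.val + 1 = 1 then (1 : L) else 0) v) : Subgroup ((cmDatum L 2 (Matrix.of fun i j : Fin 2 => if i.val + j.val + 1 = 2 then (1 : L)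 else 0)).Local v × (cmDatum L 1 (Matrix.of fun i j : Fin 1 => if i.val + j.val + 1 = 1 then (1 : L) else 0)).Local v))) ∧
      (∀ (ν : Measure ((cmDatum L 2 (Matrix.of fun i j : Fin 2 => if i.val + j.val + 1 = 2 then (1 : L) else 0)).Local v × (cmDatum L 1 (Matrix.of fun i j : Fin 1 => if i.val + j.val + 1 = 1 then (1 : L) else 0)).Local v)) [ν.IsHaarMeasure], MeasurePreserving e ν ν) ∧
      (u : (w.1.adicCompletion L)) = r w ∧ Valued.v (u : (w.1.adicCompletion L)) = 1 ∧ (galAdicCompletionMap (L := L) (IsCMField.complexConj L) hw) u = u ∧ (¬ ∃ z : (w.1.adicCompletion L), (u : (w.1.adicCompletion L)) = (galAdicCompletionMap (L := L) (IsCMField.complexConj L) hw) z * z) ∧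
      (∀ a : ((cmDatum L 2 (Matrix.of fun i j : Fin 2 => if i.val + j.val + 1 = 2 then (1 : L) else 0)).Local v × (cmDatum L 1 (Matrix.of fun i j : Fin 1 => if i.val + j.val + 1 = 1 then (1 : L) else 0)).Local v), (((localNonsplitEquiv (IsCMField.complexConj L) (Matrix.of fun i j : Fin 2 => if i.val + j.val + 1 = 2 then (1 : L) else 0) (IsCMField.complexConj_ne_one L) w hw) (e a).1 : ↥(unitaryGroupOfForm (galAdicCompletionMap (L := L) (IsCMField.complexConj L) hw) (placeForm (Matrix.of fun i j : Fin 2 => if i.val + j.val + 1 = 2 then (1 : L) else 0) w.1))) : GL (Fin 2) (w.1.adicCompletion L)) =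
        glDiagonal 2 (w.1.adicCompletion L) ![1, u] * (((localNonsplitEquiv (IsCMField.complexConj L) (Matrix.of fun i j : Fin 2 => if i.val + j.val + 1 = 2 then (1 : L) else 0) (IsCMField.complexConj_ne_one L) w hw) a.1 : ↥(unitaryGroupOfForm (galAdicCompletionMap (L := L) (IsCMField.complexConj L) hw) (placeForm (Matrix.of fun i j : Fin 2 => if i.val + j.val + 1 = 2 then (1 : L) else 0) w.1))) : GL (Fin 2) (w.1.adicCompletion L)) * (glDiagonal 2 (w.1.adicCompletion L) ![1, u])⁻¹) ∧
      glDiagonal 2 (w.1.adicCompletion L) ![1, u] ∈ glInt 2 (w.1.adicCompletion L) ∧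
      ∀ S : Subgroup (GL (Fin 2) (w.1.adicCompletion L)), (∀ s, glDiagonal 2 (w.1.adicCompletion L) ![1, u] * s * (glDiagonal 2 (w.1.adicCompletion L) ![1, u])⁻¹ ∈ S ↔ s ∈ S) →
        ∀ a : ((cmDatum L 2 (Matrix.of fun i j : Fin 2 => if i.val + j.val + 1 = 2 then (1 : L) else 0)).Local v × (cmDatum L 1 (Matrix.of fun i j : Fin 1 => if i.val + j.val + 1 = 1 then (1 : L) else 0)).Local v), (((localNonsplitEquiv (IsCMField.complexConj L) (Matrix.of fun i j : Fin 2 => if i.val + j.val + 1 = 2 then (1 : L) else 0) (IsCMField.complexConj_ne_one L) w hw) (e a).1 : ↥(unitaryGroupOfForm (galAdicCompletionMap (L := L) (IsCMField.complexConj L) hw) (placeForm (Matrix.of fun i j : Fin 2 => if i.val + j.val + 1 = 2 then (1 : L) else 0) w.1))) : GL (Fin 2) (w.1.adicCompletion L)) ∈ S ↔ (((localNonsplitEquiv (IsCMField.complexConj L) (Matrix.of fun i j : Fin 2 => if i.val + j.val + 1 = 2 then (1 : L) else 0) (IsCMField.complexConj_ne_one L) w hw) a.1 : ↥(unitaryGroupOfForm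 (galAdicCompletionMap (L := L) (IsCMField.complexConj L) hw) (placeForm (Matrix.of fun i j : Fin 2 => if i.val + j.val + 1 = 2 then (1 : L) else 0) w.1))) : GL (Fin 2) (w.1.adicCompletion L)) ∈ S :=
  exists_unitSimilitudePartner_onePlace_of_ramified L v w hw (ramificationIdx'_ne_one_of_not_isUnramifiedIn L v hv hram w) t₀ P d ht₀ hP hd1

end Package

end Literature.NumberTheory.Rogawski1990

end
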